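import Mathlib
import HarnessLib
import Summits.HubbardSuperconductivity.HubbardSuperconductivity.Theorems.KLProgrammeC4aPartnerBandChartPoint
import Summits.HubbardSuperconductivity.HubbardSuperconductivity.Theorems.KLProgrammeC4aPartnerBandCooperDefect
import Summits.HubbardSuperconductivity.HubbardSuperconductivity.Theorems.KLProgrammeC4aChordMidpointDepth

/-!
# Route `KLProgramme` — crux C4a, S3 brick (B4)/(B5) «(B4)-DIRECT-PACK», part 2: the COOPER CLASS KEYED ON THE CHORD LENGTH `s = ‖S‖` —
# slope ceiling `∝ s`, dichotomy thresholds `∝ s`, the sheets discharged, and `s ≳ |ρ| + ‖ϑ − π‖_𝕋`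

Cell `gate-hubbard-kl`, seat hubbard-kl-k3c3-p3 (g27; row «implicit-function / monotonicity route for μ(n)»).  Located brick for the (C)-closer lane
hubbard-kl-c4a-1 (stub (C) `stub_twoLeg_curvature` of `KLRegimeEngineV17F2`, stmt-HubbardSuperconductivity-20437), memo HOME/hubbard-kl-k3c3-p3/B4-DIRECT-PACK.md §2.

WHY RE-KEY.  The Cooper rows of `…C4aAbsBubbleRows` (p647885) / `…C4aAbsBubbleCooperSlope` (p648339) are keyed on the TUBE ANGLE `η = ‖ϑ − π‖_𝕋` only: the
dichotomy thresholds are `ĉ₀η, ĉ₁η` but the slope ceiling is `K₂(|ρ|/(Dt−2A) + msD₁|ϑ−π|)msD₁`, NOT `∝ η` — at `ϑ = π, ρ ≠ 0` the row is void and the cell count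
`N ≍ ceiling/threshold ≍ |ρ|/η` of `…C4aSublevelCounting` is not integrable in `ϑ`.  The natural scale of a near-Cooper configuration is the distance to the Cooper
configuration `S = 0`, i.e. the CHORD LENGTH `s := ‖S‖ = ‖Φ(0,θ) + Φ(ρ,ϑ+θ)‖`, which dominates BOTH `|ρ|` and `‖ϑ − π‖_𝕋`:
* §1 **`abs_deriv_partnerBand_pp_angle_le_chord`**: `|∂_φē| ≤ K₂·msD₁·s` at every loop point (the slope vanishes identically at `S = 0` by exact nesting and is
  `K₂`-Lipschitz in `S`; p648339's proof stopped one line earlier); **`abs_le_mul_norm_pairSum`**: `|ρ| ≤ K₁·s` (`ρ = e_K(Φ(ρ,ϑ+θ)) − e_K(−Φ(0,θ))`, `e_K` even and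
  `K₁`-Lipschitz); **`torusDist_sub_pi_le_norm_pairSum`**: `(2u_min/π)‖ϑ − π‖_𝕋 ≤ s` (g19's Cooper chord).
* §2 **`abs_deriv_partnerBand_pp_angle_gt_chord_scale`**: part 1's sheet-uniform row with `λ = ĉ₁s`, `ε = ĉ₀s`: the non-Cooper hypothesis relative to the direct sheet
  is the `s`-FREE smallness condition `X(ĉ₀,ĉ₁) := msD₁τ(ĉ₁,ĉ₀) + ĉ₀/(Dt−2A) < 1`, relative to the sheets `m ≠ 0` it follows from `s ≤ π`; the caustic conditions stay.
* §3 **discharging the sheets**: every tube point has coordinates of modulus `< π − 3/10` (part 1), so `|S_i| < 2π − 3/5`, `‖S − 2πm‖ > 3/5` and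
  `‖S − 2πm − 2Φ(0,α)‖ > 3/5 − s` for `m ≠ 0`, while `‖S − 2Φ(0,α)‖ ≥ 2u_min − s`; hence (**`abs_deriv_partnerBand_pp_angle_gt_cooper_chord`**) in the Cooper window
  `0 < s`, `s·X + 2|e|/(Dt−2A) + s < min(3/5, 2u_min)` the scaled dichotomy `|ē − e| ≤ ĉ₀s → ĉ₁s < |∂_φē|` holds at EVERY loop angle, with NO located datum —
  together with §1's ceiling this is the `(hL, hdich, hN)` input of `…C4aAbsBubbleLevelLoop.level_loop_inv_envelope_le_cooper` at scale `η := s` with an `s`-FREE `N`.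
Pure bookkeeping/calculus on landed objects (binder shape = `…C4aLoopAlignment` + the `K₁, K₂` rows of `…C4aPartnerBandCooperDefect`); nothing about the model's sizes;
nothing asserts (C), K3 or superconductivity.  References: FST II CPAM 51 (1998) §3 Thm 3.5 [cite: FeldmanSalmhoferTrubowitz1998]; Salmhofer 1999 §4.5.3 Cor. 4.11
[cite: Salmhofer1999]; BGM 2003 §7.1 Lemma 7.1 [cite: BenfattoGiulianiMastropietro2003].
-/

noncomputable section

namespace Summit.HubbardSuperconductivity.HubbardSuperconductivity.Theorems.C4a

set_option linter.dupNamespace false -- summit = problem name (single-conjunct summit), D-0017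

open Real Set
open Literature.MathematicalPhysics.QuantumLattice Literature.MathematicalPhysics.QuantumLattice.BandSectorCounting
open Literature.MathematicalPhysics.QuantumLattice.FermiRG
open Summit.HubbardSuperconductivity.HubbardSuperconductivity.Theorems.KLRegimeSplit
open Summit.HubbardSuperconductivity.HubbardSuperconductivity.Theorems.DispersionFlow
open Summit.HubbardSuperconductivity.HubbardSuperconductivity.Theorems.PerturbedFermiCurve

/-- The lattice vector `2πm` has norm `≥ 2π` for `m ≠ 0`, hence `‖q − 2πm‖ ≥ 2π − ‖q‖`. -/
theorem norm_sub_twoPi_ge (q : Momentum) {m : Fin 2 → ℤ} (hm : m ≠ 0) :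
    2 * π - ‖q‖ ≤ ‖q - WithLp.toLp 2 (fun i => 2 * π * (m i : ℝ))‖ := by
  set v : Momentum := WithLp.toLp 2 (fun i => 2 * π * (m i : ℝ)) with hv
  obtain ⟨i, hi⟩ : ∃ i, m i ≠ 0 := by
    by_contra h
    push Not at h
    exact hm (funext h)
  have hmi : (1 : ℝ) ≤ |(m i : ℝ)| := by
    rw [← Int.cast_abs]; exact_mod_cast Int.one_le_abs hi
  have hvi : 2 * π ≤ ‖v‖ := by
    refine le_trans ?_ (PiLp.norm_apply_le v i)
    rw [hv]
    simp only [Real.norm_eq_abs, abs_mul, abs_of_pos (by positivity : (0 : ℝ) < 2 * π)]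
    nlinarith [Real.pi_pos]
  have h := norm_sub_norm_le v q
  rw [norm_sub_rev] at h
  linarith

section Sizes

variable {K : TrigPolyC4v} {A : ℝ} (hA : ∀ p : Momentum, ∀ j ≤ 2, ‖iteratedFDeriv ℝ j (frameShift K) p‖ ≤ A) (hA20 : A ≤ 1 / 20)
  (hd : klCurveD ≤ (bandBounds (show (-4 : ℝ) < -1.1 by norm_num) (show (-1.1 : ℝ) ≤ -0.1 by norm_num)
    (show (-0.1 : ℝ) < 0 by norm_num)).Dtmin - 2 * A)
  {μ r : ℝ} (hr : 0 < r) (hlo : (-1.1 : ℝ) < μ - r - A) (hhi : μ + r + A < -0.1)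
  {A₃ A₄ : ℝ} (hA₃ : ∀ p : Momentum, ‖iteratedFDeriv ℝ 3 (frameShift K) p‖ ≤ A₃)
  (hA₄ : ∀ p : Momentum, ‖iteratedFDeriv ℝ 4 (frameShift K) p‖ ≤ A₄)
  {K₁ K₂ : ℝ} (hK₁ : ∀ p : Momentum, ‖fderiv ℝ (frameLevel μ K) p‖ ≤ K₁) (hK₂ : ∀ p : Momentum, ‖iteratedFDeriv ℝ 2 (frameLevel μ K) p‖ ≤ K₂)
include hA hA20 hd hr hlo hhi hA₃ hA₄ hK₁ hK₂

/-! ## §1 The chord length controls the slope, the level offset and the tube angle -/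

omit hr hK₁ in
/-- **COOPER SLOPE CEILING KEYED ON THE CHORD**: `|∂_φ e_K(S − Φ(e,φ+θ))| ≤ K₂·‖S‖·msD₁` at every loop point (`|e| < r`), for every configuration.  The slope
vanishes identically at `S = 0` (exact nesting: the loop stays on its own level set) and `De_K` is `K₂`-Lipschitz. [cite: FeldmanSalmhoferTrubowitz1998, §3 Thm 3.5] -/
theorem abs_deriv_partnerBand_pp_angle_le_chord (ρ : ℝ) {e : ℝ} (he : |e| < r) (ϑ θ φ : ℝ) :
    |deriv (fun x : ℝ => frameLevel μ K (pairSumPath μ K ρ ϑ θ 0 - levelPoint μ K e (x + θ))) φ| ≤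
      K₂ * ‖pairSumPath μ K ρ ϑ θ 0‖ * msD A₃ A₄ 1 := by
  set S : Momentum := pairSumPath μ K ρ ϑ θ 0 with hSdef
  set v : Momentum := iteratedDeriv 1 (levelPoint μ K e) (φ + θ) with hvdef
  set p : Momentum := levelPoint μ K e (φ + θ) with hpdef
  have hder := (hasDerivAt_partnerBand_pp_angle hA hd hlo hhi (ρ := ρ) he ϑ θ φ).deriv
  -- the slope at the Cooper configuration vanishes: `x ↦ e_K(0 − Φ(e,x+θ)) ≡ e`
  have hcoop := hasDerivAt_partnerBand_pp_angle hA hd hlo hhi (ρ := (0 : ℝ)) he π θ φ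
  rw [pairSumPath_cooper] at hcoop
  have hconst : HasDerivAt (fun x : ℝ => frameLevel μ K ((0 : Momentum) - levelPoint μ K e (x + θ))) 0 φ := by
    have hfun : (fun x : ℝ => frameLevel μ K ((0 : Momentum) - levelPoint μ K e (x + θ))) = fun _ => e :=
      funext fun x => by rw [zero_sub]; exact frameLevel_neg_levelPoint_tube hA hlo hhi he (x + θ)
    rw [hfun]; exact hasDerivAt_const φ e
  have hzero : -fderiv ℝ (frameLevel μ K) ((0 : Momentum) - p) v = 0 := hcoop.unique hconst
  have hzero' : fderiv ℝ (frameLevel μ K) ((0 : Momentum) - p) v = 0 := by rwa [neg_eq_zero] at hzero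
  have hval : deriv (fun x : ℝ => frameLevel μ K (pairSumPath μ K ρ ϑ θ 0 - levelPoint μ K e (x + θ))) φ =
      -((fderiv ℝ (frameLevel μ K) (S - p) - fderiv ℝ (frameLevel μ K) ((0 : Momentum) - p)) v) := by
    rw [hder, show (fderiv ℝ (frameLevel μ K) (S - p) - fderiv ℝ (frameLevel μ K) ((0 : Momentum) - p)) v =
        fderiv ℝ (frameLevel μ K) (S - p) v - fderiv ℝ (frameLevel μ K) ((0 : Momentum) - p) v from rfl, hzero', sub_zero]
  have hv : ‖v‖ ≤ msD A₃ A₄ 1 := norm_iteratedDeriv_levelPoint_le hA hA20 hd hlo hhi hA₃ hA₄ he (i := 1) le_rfl (by norm_num) (φ + θ)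
  have hL : ‖fderiv ℝ (frameLevel μ K) (S - p) - fderiv ℝ (frameLevel μ K) ((0 : Momentum) - p)‖ ≤ K₂ * ‖S‖ := by
    have h := norm_fderiv_frameLevel_sub_le hK₂ (S - p) ((0 : Momentum) - p)
    rwa [show S - p - ((0 : Momentum) - p) = S by abel] at h
  have hK₂0 : 0 ≤ K₂ := (norm_nonneg _).trans (hK₂ 0)
  rw [hval, abs_neg, ← Real.norm_eq_abs]
  calc ‖(fderiv ℝ (frameLevel μ K) (S - p) - fderiv ℝ (frameLevel μ K) ((0 : Momentum) - p)) v‖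
      ≤ ‖fderiv ℝ (frameLevel μ K) (S - p) - fderiv ℝ (frameLevel μ K) ((0 : Momentum) - p)‖ * ‖v‖ := ContinuousLinearMap.le_opNorm _ _
    _ ≤ K₂ * ‖S‖ * msD A₃ A₄ 1 := mul_le_mul hL hv (norm_nonneg _) (by positivity)

omit hA20 hd hA₃ hA₄ hK₂ in
/-- **THE LEVEL OFFSET IS DOMINATED BY THE CHORD**: `|ρ| ≤ K₁·‖S‖` — `ρ = e_K(Φ(ρ,ϑ+θ)) − e_K(−Φ(0,θ))` (`e_K` is even: `e_K(−Φ(0,θ)) = 0`) and `e_K` is `K₁`-Lipschitz,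
while `Φ(ρ,ϑ+θ) − (−Φ(0,θ)) = S`. -/
theorem abs_le_mul_norm_pairSum {ρ : ℝ} (hρ : |ρ| < r) (ϑ θ : ℝ) : |ρ| ≤ K₁ * ‖pairSumPath μ K ρ ϑ θ 0‖ := by
  have h0 : |(0 : ℝ)| < r := by simpa using hr
  have h1 : frameLevel μ K (levelPoint μ K ρ (ϑ + θ)) = ρ :=
    frameLevel_levelPoint_tube (bandBounds (show (-4 : ℝ) < -1.1 by norm_num) (show (-1.1 : ℝ) ≤ -0.1 by norm_num) (show (-0.1 : ℝ) < 0 by norm_num))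
      hA hlo hhi hρ _
  have h2 : frameLevel μ K (-levelPoint μ K 0 θ) = 0 := frameLevel_neg_levelPoint_tube hA hlo hhi h0 θ
  have h := abs_frameLevel_sub_le hK₁ (levelPoint μ K ρ (ϑ + θ)) (-levelPoint μ K 0 θ)
  rw [h1, h2, sub_zero, sub_neg_eq_add] at h
  have hS : pairSumPath μ K ρ ϑ θ 0 = levelPoint μ K ρ (ϑ + θ) + levelPoint μ K 0 θ := by
    simp only [pairSumPath, add_zero]; abel
  rwa [hS]

omit hA20 hd hA₃ hA₄ hK₁ hK₂ in
/-- **THE TUBE ANGLE IS DOMINATED BY THE CHORD**: `(2u_min/π)·‖ϑ − π‖_𝕋 ≤ ‖S‖` (the Cooper chord of `…C4aLoopChordBounds`). [cite: BenfattoGiulianiMastropietro2003, §7.1 Lemma 7.1] -/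
theorem torusDist_sub_pi_le_norm_pairSum {ρ : ℝ} (hρ : |ρ| < r) (ϑ θ : ℝ) :
    2 * (bandBounds (show (-4 : ℝ) < -1.1 by norm_num) (show (-1.1 : ℝ) ≤ -0.1 by norm_num) (show (-0.1 : ℝ) < 0 by norm_num)).umin / π *
        torusDist (ϑ - π) ≤ ‖pairSumPath μ K ρ ϑ θ 0‖ := by
  set B := bandBounds (show (-4 : ℝ) < -1.1 by norm_num) (show (-1.1 : ℝ) ≤ -0.1 by norm_num) (show (-0.1 : ℝ) < 0 by norm_num) with hBdef
  have hlo₀ : (-1.1 : ℝ) ≤ μ + 0 - A := by linarith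
  have hhi₀ : μ + 0 + A ≤ -0.1 := by linarith
  have hloρ : (-1.1 : ℝ) ≤ μ + ρ - A := by have := (abs_lt.1 hρ).1; linarith
  have hhiρ : μ + ρ + A ≤ -0.1 := by have := (abs_lt.1 hρ).2; linarith
  have hch := norm_levelPoint_add_ge_torusDist B hA hlo₀ hhi₀ hloρ hhiρ θ (ϑ + θ)
  have e0 : θ - (ϑ + θ) - π = -(ϑ + π) := by ring
  have eπ : ϑ + π = ϑ - π + ((1 : ℤ) : ℝ) * (2 * π) := by push_cast; ring
  have e1 : torusDist (θ - (ϑ + θ) - π) = torusDist (ϑ - π) := by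
    rw [e0, torusDist_neg', eπ, torusDist_add_int_mul_two_pi]
  have hS : pairSumPath μ K ρ ϑ θ 0 = levelPoint μ K 0 θ + levelPoint μ K ρ (ϑ + θ) := by
    simp only [pairSumPath, add_zero]
  rw [hS, ← e1]
  exact hch

/-! ## §2 The scaled dichotomy keyed on the chord, sheet-uniform -/

omit hr hK₁ hK₂ in
/-- **THE COOPER-SCALE DICHOTOMY KEYED ON THE CHORD** (sheet-uniform).  With `s = ‖S‖ > 0`, thresholds `λ = ĉ₁s`, `ε = ĉ₀s` and
`X = msD₁·τ(ĉ₁,ĉ₀) + ĉ₀/(Dt−2A)` (`τ` of part 1, LINEAR in its arguments): if `X < 1` (the `s`-FREE non-Cooper condition), `s ≤ π` (so that `S` is closer to `0` than to any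
`2πm ≠ 0`), `|ē − e| ≤ ĉ₀s`, and the loop point avoids every caustic (`s·X + 2|e|/(Dt−2A) < ‖S − 2πm − 2Φ(0,φ+θ)‖` for all `m`), then `ĉ₁s < |∂_φē|`. -/
theorem abs_deriv_partnerBand_pp_angle_gt_chord_scale {Kc r₀ g₀ w : ℝ} (hG : GeomConstants (frameLevel μ K) Kc r₀ g₀ w) {ρ e : ℝ}
    (he : |e| < r) (he₀ : |e| < r₀) {ϑ θ φ : ℝ}
    (hē : |frameLevel μ K (pairSumPath μ K ρ ϑ θ 0 - levelPoint μ K e (φ + θ))| < r) {c₀ c₁ : ℝ}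
    (hs : 0 < ‖pairSumPath μ K ρ ϑ θ 0‖) (hsπ : ‖pairSumPath μ K ρ ϑ θ 0‖ ≤ π)
    (heps : |frameLevel μ K (pairSumPath μ K ρ ϑ θ 0 - levelPoint μ K e (φ + θ)) - e| ≤ c₀ * ‖pairSumPath μ K ρ ϑ θ 0‖)
    (hX : msD A₃ A₄ 1 *
            ((π / 2 * c₁ /
                  (((bandBounds (show (-4 : ℝ) < -1.1 by norm_num) (show (-1.1 : ℝ) ≤ -0.1 by norm_num) (show (-0.1 : ℝ) < 0 by norm_num)).Dtmin -
                      2 * A) *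
                    (bandBounds (show (-4 : ℝ) < -1.1 by norm_num) (show (-1.1 : ℝ) ≤ -0.1 by norm_num) (show (-0.1 : ℝ) < 0 by norm_num)).umin) +
                π * Kc * c₀ / ((bandBounds (show (-4 : ℝ) < -1.1 by norm_num) (show (-1.1 : ℝ) ≤ -0.1 by norm_num)
                  (show (-0.1 : ℝ) < 0 by norm_num)).Dtmin - 2 * A) ^ 2) /
              ((bandBounds (show (-4 : ℝ) < -1.1 by norm_num) (show (-1.1 : ℝ) ≤ -0.1 by norm_num) (show (-0.1 : ℝ) < 0 by norm_num)).umin * w /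
                (4 + 2 * A))) +
          c₀ / ((bandBounds (show (-4 : ℝ) < -1.1 by norm_num) (show (-1.1 : ℝ) ≤ -0.1 by norm_num) (show (-0.1 : ℝ) < 0 by norm_num)).Dtmin - 2 * A) < 1)
    (hT : ∀ m : Fin 2 → ℤ, ‖pairSumPath μ K ρ ϑ θ 0‖ * (msD A₃ A₄ 1 *
            ((π / 2 * c₁ /
                  (((bandBounds (show (-4 : ℝ) < -1.1 by norm_num) (show (-1.1 : ℝ) ≤ -0.1 by norm_num) (show (-0.1 : ℝ) < 0 by norm_num)).Dtmin -
                      2 * A) *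
                    (bandBounds (show (-4 : ℝ) < -1.1 by norm_num) (show (-1.1 : ℝ) ≤ -0.1 by norm_num) (show (-0.1 : ℝ) < 0 by norm_num)).umin) +
                π * Kc * c₀ / ((bandBounds (show (-4 : ℝ) < -1.1 by norm_num) (show (-1.1 : ℝ) ≤ -0.1 by norm_num)
                  (show (-0.1 : ℝ) < 0 by norm_num)).Dtmin - 2 * A) ^ 2) /
              ((bandBounds (show (-4 : ℝ) < -1.1 by norm_num) (show (-1.1 : ℝ) ≤ -0.1 by norm_num) (show (-0.1 : ℝ) < 0 by norm_num)).umin * w /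
                (4 + 2 * A))) +
          c₀ / ((bandBounds (show (-4 : ℝ) < -1.1 by norm_num) (show (-1.1 : ℝ) ≤ -0.1 by norm_num) (show (-0.1 : ℝ) < 0 by norm_num)).Dtmin - 2 * A)) +
          2 * |e| / ((bandBounds (show (-4 : ℝ) < -1.1 by norm_num) (show (-1.1 : ℝ) ≤ -0.1 by norm_num) (show (-0.1 : ℝ) < 0 by norm_num)).Dtmin - 2 * A) <
        ‖pairSumPath μ K ρ ϑ θ 0 - WithLp.toLp 2 (fun i => 2 * π * (m i : ℝ)) - (2 : ℝ) • levelPoint μ K 0 (φ + θ)‖) :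
    c₁ * ‖pairSumPath μ K ρ ϑ θ 0‖ < |deriv (fun x : ℝ => frameLevel μ K (pairSumPath μ K ρ ϑ θ 0 - levelPoint μ K e (x + θ))) φ| := by
  set B := bandBounds (show (-4 : ℝ) < -1.1 by norm_num) (show (-1.1 : ℝ) ≤ -0.1 by norm_num) (show (-0.1 : ℝ) < 0 by norm_num) with hBdef
  set s := ‖pairSumPath μ K ρ ϑ θ 0‖ with hsdef
  set X := msD A₃ A₄ 1 * ((π / 2 * c₁ / ((B.Dtmin - 2 * A) * B.umin) + π * Kc * c₀ / (B.Dtmin - 2 * A) ^ 2) / (B.umin * w / (4 + 2 * A))) +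
      c₀ / (B.Dtmin - 2 * A) with hXdef
  -- the `(λ, ε) = (ĉ₁s, ĉ₀s)` thresholds: the left-hand sides of part 1's `hC`/`hT` are `s·X` and `s·X + 2|e|/(Dt−2A)`
  have key : msD A₃ A₄ 1 * ((π / 2 * (c₁ * s) / ((B.Dtmin - 2 * A) * B.umin) + π * Kc * (c₀ * s) / (B.Dtmin - 2 * A) ^ 2) /
        (B.umin * w / (4 + 2 * A))) + c₀ * s / (B.Dtmin - 2 * A) = s * X := by
    rw [hXdef]; ring
  have key2 : msD A₃ A₄ 1 * ((π / 2 * (c₁ * s) / ((B.Dtmin - 2 * A) * B.umin) + π * Kc * (c₀ * s) / (B.Dtmin - 2 * A) ^ 2) /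
        (B.umin * w / (4 + 2 * A))) + (2 * |e| + c₀ * s) / (B.Dtmin - 2 * A) = s * X + 2 * |e| / (B.Dtmin - 2 * A) := by
    rw [hXdef]; ring
  refine abs_deriv_partnerBand_pp_angle_gt_of_sheets hA hA20 hd hlo hhi hA₃ hA₄ hG he he₀ hē (lam := c₁ * s) (eps := c₀ * s) heps ?_ ?_
  · intro m
    rw [key]
    have hsX : s * X < s := by nlinarith
    by_cases hm : m = 0
    · -- the direct sheet: `‖S − 0‖ = s`
      have hv0 : (WithLp.toLp 2 (fun i => 2 * π * (m i : ℝ)) : Momentum) = 0 := by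
        ext i; simp [hm]
      rw [hv0, sub_zero]
      exact hsX
    · -- umklapp sheets: `‖S − 2πm‖ ≥ 2π − s ≥ s`
      have h := norm_sub_twoPi_ge (pairSumPath μ K ρ ϑ θ 0) hm
      rw [← hsdef] at h
      linarith [Real.pi_gt_three]
  · intro m
    rw [key2]
    exact hT m

/-! ## §3 Discharging the sheets: coordinates of tube points, the umklapp margins, the Cooper window -/

omit hA20 hd hr hA₃ hA₄ hK₁ hK₂ in
/-- **Coordinates of chart points**: `|Φ(e,α)_i| < π − 3/10` on the tube `|e| < r` of the analysis window (part 1's boundary margin at the chart point). -/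
theorem abs_levelPoint_apply_lt {e : ℝ} (he : |e| < r) (α : ℝ) (i : Fin 2) : |levelPoint μ K e α i| < π - 3 / 10 := by
  set B := bandBounds (show (-4 : ℝ) < -1.1 by norm_num) (show (-1.1 : ℝ) ≤ -0.1 by norm_num) (show (-0.1 : ℝ) < 0 by norm_num) with hBdef
  have heI := abs_lt.1 he
  -- the chart point is a tube point of the closed zone
  have hδc : Continuous (fun k : Fin 2 → ℝ => -K.eval k) := by
    rw [← frameShift_toLp_eq_neg_eval]; exact continuous_frameShift_toLp K
  have hδ : ∀ k : Fin 2 → ℝ, (∀ i, |k i| ≤ π) → |(fun p : Fin 2 → ℝ => -K.eval p) k| ≤ A := fun k _ => by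
    simpa [frameShift_toLp] using abs_frameShift_toLp_le hA k
  have hsq : ∀ j, |klFermiPoint (μ + e) K α j| ≤ π := fun j =>
    (abs_perturbedFermiRadius_smul_dir_lt B hδc hδ (μ := μ + e) (by linarith) (by linarith) α j).le
  have hlev : |frameLevel μ K (WithLp.toLp 2 (klFermiPoint (μ + e) K α))| < r := by
    have h : frameLevel μ K (levelPoint μ K e α) = e := frameLevel_levelPoint_tube B hA hlo hhi he α
    rw [levelPoint] at h
    rw [h]; exact he
  have h := abs_apply_lt_pi_sub_of_abs_frameLevel_lt hA hhi.le (by norm_num) hsq hlev i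
  rw [show levelPoint μ K e α i = klFermiPoint (μ + e) K α i from rfl]
  exact h

omit hA20 hd hA₃ hA₄ hK₁ hK₂ in
/-- **Coordinates of the pair sum**: `|S_i| < 2π − 3/5`. -/
theorem abs_pairSumPath_apply_lt {ρ : ℝ} (hρ : |ρ| < r) (ϑ θ : ℝ) (i : Fin 2) : |pairSumPath μ K ρ ϑ θ 0 i| < 2 * π - 3 / 5 := by
  have h0 : |(0 : ℝ)| < r := by simpa using hr
  have hS : pairSumPath μ K ρ ϑ θ 0 i = levelPoint μ K 0 θ i + levelPoint μ K ρ (ϑ + θ) i := by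
    simp only [pairSumPath, add_zero, PiLp.add_apply]
  rw [hS]
  have h1 := abs_levelPoint_apply_lt hA hlo hhi h0 θ i
  have h2 := abs_levelPoint_apply_lt hA hlo hhi hρ (ϑ + θ) i
  have := abs_add_le (levelPoint μ K 0 θ i) (levelPoint μ K ρ (ϑ + θ) i)
  linarith

omit hA20 hd hA₃ hA₄ hK₁ hK₂ in
/-- **Umklapp sheets are never Cooper**: `3/5 < ‖S − 2πm‖` for `m ≠ 0`. -/
theorem norm_pairSum_sub_twoPi_gt {ρ : ℝ} (hρ : |ρ| < r) (ϑ θ : ℝ) {m : Fin 2 → ℤ} (hm : m ≠ 0) :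
    3 / 5 < ‖pairSumPath μ K ρ ϑ θ 0 - WithLp.toLp 2 (fun i => 2 * π * (m i : ℝ))‖ := by
  obtain ⟨i, hi⟩ : ∃ i, m i ≠ 0 := by
    by_contra h
    push Not at h
    exact hm (funext h)
  have hmi : (1 : ℝ) ≤ |(m i : ℝ)| := by
    rw [← Int.cast_abs]; exact_mod_cast Int.one_le_abs hi
  have hSi := abs_pairSumPath_apply_lt hA hr hlo hhi hρ ϑ θ i
  refine lt_of_lt_of_le ?_ (PiLp.norm_apply_le (pairSumPath μ K ρ ϑ θ 0 - WithLp.toLp 2 (fun i => 2 * π * (m i : ℝ))) i)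
  rw [PiLp.sub_apply, PiLp.toLp_apply, Real.norm_eq_abs]
  have h1 : 2 * π * |(m i : ℝ)| - |pairSumPath μ K ρ ϑ θ 0 i| ≤ |pairSumPath μ K ρ ϑ θ 0 i - 2 * π * (m i : ℝ)| := by
    have h := abs_sub_abs_le_abs_sub (2 * π * (m i : ℝ)) (pairSumPath μ K ρ ϑ θ 0 i)
    rw [abs_mul, abs_of_pos (by positivity : (0 : ℝ) < 2 * π), abs_sub_comm] at h
    exact h
  nlinarith [Real.pi_pos, Real.pi_gt_three]

omit hA20 hd hA₃ hA₄ hK₁ hK₂ in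
/-- **Umklapp caustic margin**: `3/5 − ‖S‖ < ‖S − 2πm − 2Φ(0,α)‖` for `m ≠ 0` (`|2πm_i + 2Φ(0,α)_i| > 2π − 2(π − 3/10)`). -/
theorem norm_pairSum_sub_twoPi_sub_two_gt (ρ ϑ θ α : ℝ) {m : Fin 2 → ℤ} (hm : m ≠ 0) :
    3 / 5 - ‖pairSumPath μ K ρ ϑ θ 0‖ < ‖pairSumPath μ K ρ ϑ θ 0 - WithLp.toLp 2 (fun i => 2 * π * (m i : ℝ)) - (2 : ℝ) • levelPoint μ K 0 α‖ := by
  have h0 : |(0 : ℝ)| < r := by simpa using hr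
  obtain ⟨i, hi⟩ : ∃ i, m i ≠ 0 := by
    by_contra h
    push Not at h
    exact hm (funext h)
  have hmi : (1 : ℝ) ≤ |(m i : ℝ)| := by
    rw [← Int.cast_abs]; exact_mod_cast Int.one_le_abs hi
  set S : Momentum := pairSumPath μ K ρ ϑ θ 0 with hSdef
  set W : Momentum := WithLp.toLp 2 (fun i => 2 * π * (m i : ℝ)) + (2 : ℝ) • levelPoint μ K 0 α with hWdef
  have hΦ := abs_levelPoint_apply_lt hA hlo hhi h0 α i
  -- `‖W‖ > 3/5`
  have hWi : 3 / 5 < ‖W‖ := by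
    refine lt_of_lt_of_le ?_ (PiLp.norm_apply_le W i)
    rw [hWdef, PiLp.add_apply, PiLp.smul_apply, PiLp.toLp_apply, Real.norm_eq_abs, smul_eq_mul]
    have h := abs_sub_abs_le_abs_sub (2 * π * (m i : ℝ)) (-(2 * levelPoint μ K 0 α i))
    rw [abs_neg, abs_mul, abs_of_pos (by positivity : (0 : ℝ) < 2 * π), abs_mul, abs_two, sub_neg_eq_add] at h
    nlinarith [Real.pi_pos, Real.pi_gt_three]
  have hSW : S - WithLp.toLp 2 (fun i => 2 * π * (m i : ℝ)) - (2 : ℝ) • levelPoint μ K 0 α = S - W := by rw [hWdef]; abel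
  rw [hSW]
  have h := norm_sub_norm_le W S
  rw [norm_sub_rev] at h
  linarith

omit hA20 hd hA₃ hA₄ hK₁ hK₂ in
/-- **Direct tangency-corner margin near Cooper**: `2u_min − ‖S‖ ≤ ‖S − 2Φ(0,α)‖` (`‖Φ(0,α)‖ = u_K(α) ≥ u_min`). -/
theorem norm_pairSum_sub_two_ge (ρ ϑ θ α : ℝ) :
    2 * (bandBounds (show (-4 : ℝ) < -1.1 by norm_num) (show (-1.1 : ℝ) ≤ -0.1 by norm_num) (show (-0.1 : ℝ) < 0 by norm_num)).umin -
        ‖pairSumPath μ K ρ ϑ θ 0‖ ≤ ‖pairSumPath μ K ρ ϑ θ 0 - (2 : ℝ) • levelPoint μ K 0 α‖ := by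
  set B := bandBounds (show (-4 : ℝ) < -1.1 by norm_num) (show (-1.1 : ℝ) ≤ -0.1 by norm_num) (show (-0.1 : ℝ) < 0 by norm_num) with hBdef
  have hu : B.umin ≤ ‖levelPoint μ K 0 α‖ := by
    rw [levelPoint_eq_toLp_smul_dir, norm_toLp_smul_dir, add_zero]
    exact (KLRegimeSplit.umin_le_frameRadius B hA (μ := μ) (by linarith) (by linarith) α).trans (le_abs_self _)
  have h2 : ‖(2 : ℝ) • levelPoint μ K 0 α‖ = 2 * ‖levelPoint μ K 0 α‖ := by rw [norm_smul, Real.norm_eq_abs, abs_two]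
  have h := norm_sub_norm_le ((2 : ℝ) • levelPoint μ K 0 α) (pairSumPath μ K ρ ϑ θ 0)
  rw [norm_sub_rev, h2] at h
  linarith

omit hr hK₁ hK₂ in
/-- **THE COOPER CLASS ROW, FULLY DISCHARGED** (no located datum): in the Cooper window `0 < s = ‖S‖`, `s·X + 2|e|/(Dt−2A) + s < min(3/5, 2u_min)` (hence `s ≤ π`),
with the `s`-free smallness `X(ĉ₀,ĉ₁) < 1`, the scaled dichotomy `|ē − e| ≤ ĉ₀s → ĉ₁s < |∂_φē|` holds at EVERY loop angle `φ` and every loop level `|e| < r`,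
`|e| < r₀` with `|ē| < r` — the `hdich` of `level_loop_inv_envelope_le_cooper` at scale `η := s`. [cite: Salmhofer1999, §4.5.3 Cor. 4.11] -/
theorem abs_deriv_partnerBand_pp_angle_gt_cooper_chord {Kc r₀ g₀ w : ℝ} (hG : GeomConstants (frameLevel μ K) Kc r₀ g₀ w) {ρ e : ℝ}
    (he : |e| < r) (he₀ : |e| < r₀) {ϑ θ φ : ℝ}
    (hē : |frameLevel μ K (pairSumPath μ K ρ ϑ θ 0 - levelPoint μ K e (φ + θ))| < r) {c₀ c₁ : ℝ}
    (hs : 0 < ‖pairSumPath μ K ρ ϑ θ 0‖)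
    (heps : |frameLevel μ K (pairSumPath μ K ρ ϑ θ 0 - levelPoint μ K e (φ + θ)) - e| ≤ c₀ * ‖pairSumPath μ K ρ ϑ θ 0‖)
    (hX : (msD A₃ A₄ 1 *
            ((π / 2 * c₁ /
                  (((bandBounds (show (-4 : ℝ) < -1.1 by norm_num) (show (-1.1 : ℝ) ≤ -0.1 by norm_num) (show (-0.1 : ℝ) < 0 by norm_num)).Dtmin -
                      2 * A) *
                    (bandBounds (show (-4 : ℝ) < -1.1 by norm_num) (show (-1.1 : ℝ) ≤ -0.1 by norm_num) (show (-0.1 : ℝ) < 0 by norm_num)).umin) +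
                π * Kc * c₀ / ((bandBounds (show (-4 : ℝ) < -1.1 by norm_num) (show (-1.1 : ℝ) ≤ -0.1 by norm_num)
                  (show (-0.1 : ℝ) < 0 by norm_num)).Dtmin - 2 * A) ^ 2) /
              ((bandBounds (show (-4 : ℝ) < -1.1 by norm_num) (show (-1.1 : ℝ) ≤ -0.1 by norm_num) (show (-0.1 : ℝ) < 0 by norm_num)).umin * w /
                (4 + 2 * A))) +
          c₀ / ((bandBounds (show (-4 : ℝ) < -1.1 by norm_num) (show (-1.1 : ℝ) ≤ -0.1 by norm_num) (show (-0.1 : ℝ) < 0 by norm_num)).Dtmin - 2 * A)) < 1)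
    (hwin : ‖pairSumPath μ K ρ ϑ θ 0‖ * (msD A₃ A₄ 1 *
            ((π / 2 * c₁ /
                  (((bandBounds (show (-4 : ℝ) < -1.1 by norm_num) (show (-1.1 : ℝ) ≤ -0.1 by norm_num) (show (-0.1 : ℝ) < 0 by norm_num)).Dtmin -
                      2 * A) *
                    (bandBounds (show (-4 : ℝ) < -1.1 by norm_num) (show (-1.1 : ℝ) ≤ -0.1 by norm_num) (show (-0.1 : ℝ) < 0 by norm_num)).umin) +
                π * Kc * c₀ / ((bandBounds (show (-4 : ℝ) < -1.1 by norm_num) (show (-1.1 : ℝ) ≤ -0.1 by norm_num)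
                  (show (-0.1 : ℝ) < 0 by norm_num)).Dtmin - 2 * A) ^ 2) /
              ((bandBounds (show (-4 : ℝ) < -1.1 by norm_num) (show (-1.1 : ℝ) ≤ -0.1 by norm_num) (show (-0.1 : ℝ) < 0 by norm_num)).umin * w /
                (4 + 2 * A))) +
          c₀ / ((bandBounds (show (-4 : ℝ) < -1.1 by norm_num) (show (-1.1 : ℝ) ≤ -0.1 by norm_num) (show (-0.1 : ℝ) < 0 by norm_num)).Dtmin - 2 * A)) +
          2 * |e| / ((bandBounds (show (-4 : ℝ) < -1.1 by norm_num) (show (-1.1 : ℝ) ≤ -0.1 by norm_num) (show (-0.1 : ℝ) < 0 by norm_num)).Dtmin - 2 * A) +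
          ‖pairSumPath μ K ρ ϑ θ 0‖ < 3 / 5)
    (hwin' : ‖pairSumPath μ K ρ ϑ θ 0‖ * (msD A₃ A₄ 1 *
            ((π / 2 * c₁ /
                  (((bandBounds (show (-4 : ℝ) < -1.1 by norm_num) (show (-1.1 : ℝ) ≤ -0.1 by norm_num) (show (-0.1 : ℝ) < 0 by norm_num)).Dtmin -
                      2 * A) *
                    (bandBounds (show (-4 : ℝ) < -1.1 by norm_num) (show (-1.1 : ℝ) ≤ -0.1 by norm_num) (show (-0.1 : ℝ) < 0 by norm_num)).umin) +
                π * Kc * c₀ / ((bandBounds (show (-4 : ℝ) < -1.1 by norm_num) (show (-1.1 : ℝ) ≤ -0.1 by norm_num)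
                  (show (-0.1 : ℝ) < 0 by norm_num)).Dtmin - 2 * A) ^ 2) /
              ((bandBounds (show (-4 : ℝ) < -1.1 by norm_num) (show (-1.1 : ℝ) ≤ -0.1 by norm_num) (show (-0.1 : ℝ) < 0 by norm_num)).umin * w /
                (4 + 2 * A))) +
          c₀ / ((bandBounds (show (-4 : ℝ) < -1.1 by norm_num) (show (-1.1 : ℝ) ≤ -0.1 by norm_num) (show (-0.1 : ℝ) < 0 by norm_num)).Dtmin - 2 * A)) +
          2 * |e| / ((bandBounds (show (-4 : ℝ) < -1.1 by norm_num) (show (-1.1 : ℝ) ≤ -0.1 by norm_num) (show (-0.1 : ℝ) < 0 by norm_num)).Dtmin - 2 * A) +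
          ‖pairSumPath μ K ρ ϑ θ 0‖ <
        2 * (bandBounds (show (-4 : ℝ) < -1.1 by norm_num) (show (-1.1 : ℝ) ≤ -0.1 by norm_num) (show (-0.1 : ℝ) < 0 by norm_num)).umin) :
    c₁ * ‖pairSumPath μ K ρ ϑ θ 0‖ < |deriv (fun x : ℝ => frameLevel μ K (pairSumPath μ K ρ ϑ θ 0 - levelPoint μ K e (x + θ))) φ| := by
  have hr' : 0 < r := lt_of_le_of_lt (abs_nonneg _) he
  have hDt : 0 < (bandBounds (show (-4 : ℝ) < -1.1 by norm_num) (show (-1.1 : ℝ) ≤ -0.1 by norm_num) (show (-0.1 : ℝ) < 0 by norm_num)).Dtmin - 2 * A := by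
    have := klCurveD_pos; linarith
  have he2 : 0 ≤ 2 * |e| / ((bandBounds (show (-4 : ℝ) < -1.1 by norm_num) (show (-1.1 : ℝ) ≤ -0.1 by norm_num) (show (-0.1 : ℝ) < 0 by norm_num)).Dtmin -
      2 * A) := by positivity
  -- for `ĉ₁ < 0` the conclusion is trivial; for `ĉ₁ ≥ 0` the smallness number `X` is nonnegative
  rcases lt_or_ge c₁ 0 with hc₁ | hc₁
  · exact (mul_neg_of_neg_of_pos hc₁ hs).trans_le (abs_nonneg _)
  have hA0 : 0 ≤ A := (norm_nonneg _).trans (hA 0 0 (by norm_num))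
  have hKc : 0 ≤ Kc := le_trans (norm_nonneg _) (hG.norm_iteratedFDeriv_le (0 : Momentum) 0 (by norm_num))
  have hM : 0 ≤ msD A₃ A₄ 1 := (norm_nonneg _).trans (norm_iteratedDeriv_levelPoint_le hA hA20 hd hlo hhi hA₃ hA₄ he le_rfl (by norm_num) 0)
  have hc₀ : 0 ≤ c₀ := by
    by_contra hneg
    push Not at hneg
    have h := (abs_nonneg _).trans heps
    nlinarith
  have hu := (bandBounds (show (-4 : ℝ) < -1.1 by norm_num) (show (-1.1 : ℝ) ≤ -0.1 by norm_num) (show (-0.1 : ℝ) < 0 by norm_num)).umin_pos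
  have hw := hG.wmin_pos
  have hsX0 : 0 ≤ ‖pairSumPath μ K ρ ϑ θ 0‖ * (msD A₃ A₄ 1 *
            ((π / 2 * c₁ /
                  (((bandBounds (show (-4 : ℝ) < -1.1 by norm_num) (show (-1.1 : ℝ) ≤ -0.1 by norm_num) (show (-0.1 : ℝ) < 0 by norm_num)).Dtmin -
                      2 * A) *
                    (bandBounds (show (-4 : ℝ) < -1.1 by norm_num) (show (-1.1 : ℝ) ≤ -0.1 by norm_num) (show (-0.1 : ℝ) < 0 by norm_num)).umin) +
                π * Kc * c₀ / ((bandBounds (show (-4 : ℝ) < -1.1 by norm_num) (show (-1.1 : ℝ) ≤ -0.1 by norm_num)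
                  (show (-0.1 : ℝ) < 0 by norm_num)).Dtmin - 2 * A) ^ 2) /
              ((bandBounds (show (-4 : ℝ) < -1.1 by norm_num) (show (-1.1 : ℝ) ≤ -0.1 by norm_num) (show (-0.1 : ℝ) < 0 by norm_num)).umin * w /
                (4 + 2 * A))) +
          c₀ / ((bandBounds (show (-4 : ℝ) < -1.1 by norm_num) (show (-1.1 : ℝ) ≤ -0.1 by norm_num) (show (-0.1 : ℝ) < 0 by norm_num)).Dtmin - 2 * A)) := by
    positivity
  have hsπ : ‖pairSumPath μ K ρ ϑ θ 0‖ ≤ π := by linarith [Real.pi_gt_three]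
  refine abs_deriv_partnerBand_pp_angle_gt_chord_scale hA hA20 hd hlo hhi hA₃ hA₄ hG he he₀ hē hs hsπ heps hX fun m => ?_
  by_cases hm : m = 0
  · have hv0 : (WithLp.toLp 2 (fun i => 2 * π * (m i : ℝ)) : Momentum) = 0 := by ext i; simp [hm]
    rw [hv0, sub_zero]
    have h := norm_pairSum_sub_two_ge hA hr' hlo hhi ρ ϑ θ (φ + θ)
    linarith
  · have h := norm_pairSum_sub_twoPi_sub_two_gt hA hr' hlo hhi ρ ϑ θ (φ + θ) hm
    linarith

end Sizes

end Summit.HubbardSuperconductivity.HubbardSuperconductivity.Theorems.C4a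

end
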